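import Summits.BirchSwinnertonDyer.BirchSwinnertonDyer.Theorems.CumulativeHeegnerLeopoldtRedSplitControlAtThreeShaTwoReadoutRoadPresentation
import Summits.BirchSwinnertonDyer.Rank1Residual.X11b.WeakLeopoldt
import Summits.BirchSwinnertonDyer.Rank1Residual.X11b.ShaTwoLevelBound
import Summits.BirchSwinnertonDyer.Rank1Residual.X11b.WeilTransport
import Literature.NumberTheory.GaloisRepresentations.HomDualShaTwoObstruction
import HarnessLib

/-!
# Poitou–Tate, degree two: the `Ш²`-readout road PLUGGED with the canonical obstruction map and ASSEMBLED
# into the named fact `poitouTate_sha_tateDual K` (Milne I Thm. 4.10 (a)) for a totally complex `K`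

Cell `bsd-wall`, seat `bsd-line-chl-p2` g6 (width prover on crux K4 `RedSplitControlAtThree`,
stmt-BirchSwinnertonDyer-24200; stub `stub_poitouTateShaTateDual` = `poitouTate_sha_tateDual K`, item 20462; the K4 closer
`RedSplitControlAtThreeOfFacts.redSplitControlAtThree_of_poitouTate_totallyComplex` consumes exactly
`∀ K` totally complex, `poitouTate_selmerStructure_duality K ∧ poitouTate_sha_tateDual K`).  Sequel of
`…ShaTwoReadoutRoadPresentation` (`shaTwo_tateDual_of_ideleProjection`: the perfect pairing
`Ш²(K, M₀^D) × Ш¹(K, M₀^{DD}) → ℤ/n` from the presentation road + a degree-`2` map `Ψ` with five properties) and of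
`HomDualShaTwoObstruction` (THE map `Ψ = HomDual.shaTwoObstruction' ρ₀ n hM` with properties (a)(b)(c) PROVED).

* §1 `shaTwo_tateDual_of_shaTwoObstruction` — the road with `Ψ := shaTwoObstruction' ρ₀ n hM` plugged in: (a)(b)(c) are
  discharged by `HomDual.shaTwoObstruction'_comp_g / _f_comp / exists_comp_g_eq_of_shaTwoObstruction'_eq_zero`; what
  remains displayed is (d) `Ψ h ∈ Ш²(K, M₀^D)` and (e) `Ш²(K, M₀^D) ⊆ Im Ψ`, besides the degree-`≤ 1` inputs of cell
  `bsd-schneider` (Tate duality record — landed —, idèle projections `π` with (R3), the bridge `nat` with (R4)) and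
  `SelmerComplement` of the canonical invariant maps.
* §2 transport along isomorphisms of discrete Galois modules: `H²(g) ∘ H²(f) = id` (`map_map_eq_self_of_comp_eq_two`),
  `Ш²` and `Ш¹` are carried along (`nonempty_shaTwo_addEquiv`, `nonempty_sha_addEquiv`, `K` totally complex for `Ш²`), a perfect pairing is carried
  along additive equivalences (`exists_perfect_of_addEquiv`), and `Ш¹(K, M)` is finite for `M` unramified outside a finite
  set (`finite_sha_of_isUnramifiedOutside`, Milne I Lemma 4.8 via the tree's `SelmerFinite`).
* §3 **`poitouTate_sha_tateDual_of_shaTwoObstruction`** — THE NAMED FACT `poitouTate_sha_tateDual K` for a totally complex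
  `K` from: the inputs above quantified over all levels `n` and all finite `n`-torsion `M₀`, the biduality `M ≅ M^{DD}`
  (`exists_bidual_intertwining`) transporting the pairing from `(Ш²(M^{DD}), Ш¹(M^{DDD}))` to `(Ш²(M), Ш¹(M^D))`, and the
  finiteness of the set of ramified places of a finite Galois module (displayed hypothesis `hS₀`).

HONEST FRAMING: THEOREMS ONLY; a reduction — (R3)/(R4)/`nat` (cell `bsd-schneider`), (d), (e), `SelmerComplement` (= `hE`)
and `hS₀` are genuine displayed hypotheses; closes no item; no case of Poitou–Tate or BSD is proved here.

References: [MilneADT2006] I Thm. 4.10 (a) and its proof (p. 58), Lemma 4.8, Lemma 4.13, Thm. 1.8, Prop. 0.19;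
[Harari2020] Thm. 17.13 (b).
-/

noncomputable section

open Function NumberField IsDedekindDomain CategoryTheory CategoryTheory.Abelian
open scoped NumberField ContRepresentation

set_option linter.dupNamespace false
set_option autoImplicit false

namespace Summit.BirchSwinnertonDyer.BirchSwinnertonDyer.Theorems.PoitouTateShaTwoReadout

open Field
open Literature.NumberTheory.GaloisRepresentations Literature.NumberTheory.GaloisCohomology
open Literature.NumberTheory.GaloisRepresentations.DiscreteGaloisModule (TateDual tateDual localTatePairingZMod
  unramifiedSubgroup sha shaTwo SelmerStructure mem_sha_iff mem_shaTwo_iff)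
open Literature.Algebra.Homology Literature.Algebra.Homology.DiscreteRep Literature.Algebra.Homology.ExtPresentation
open Literature.NumberTheory.GaloisRepresentations.IdeleClassBar (classBarD)
open Literature.AnabelianGeometry.AbsoluteAnabelian.Prop121vii (zmodToQmodZ)
open Literature.NumberTheory.GaloisRepresentations.FreePresentation (presentationComplex presentationComplex_shortExact)
open Literature.NumberTheory.GaloisRepresentations.HomDual (IdeleProjection readout shaTwoObstruction'
  shaTwoObstruction'_comp_g shaTwoObstruction'_f_comp exists_comp_g_eq_of_shaTwoObstruction'_eq_zero)
open Summit.BirchSwinnertonDyer.BirchSwinnertonDyer.Theorems.SchneiderFreeAdditiveX3.PoitouTateReduction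
  (exists_bidual_intertwining)
open Summit.BirchSwinnertonDyer.Rank1Residual.X11b

/-! ## §1 The road with `Ψ := shaTwoObstruction'` plugged in -/

section Plugged

variable {K : Type} [Field K] [NumberField K]

/-- **Milne I Thm. 4.10 (a) at the module `M₀^D`, from the presentation road with THE obstruction map plugged in.**
For `K` totally complex, `n ≥ 1`, a finite `n`-torsion `ρ₀` on `M₀` with `M₀^D` unramified off the finite
`S₀ ⊇ {v ∣ ∞} ∪ {v ∣ n}` and `Ш¹(K, M₀^{DD})` finite: IF Tate duality holds for `(Γ_K, C̄, inv)` (door-c4, landed), a family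
`π` of idèle projections has the (R3) property for the idèle readout, a bijection `nat : H¹(K, M₀^{DD}) ≅ Ext¹(ℤ, M₀)`
satisfies the (R4) identity, the canonical invariant maps satisfy `SelmerComplement` at level `n`, and the obstruction map
`Ψ = shaTwoObstruction' ρ₀ n hM` (d) lands in `Ш²(K, M₀^D)` and (e) exhausts it, THEN `Ш²(K, M₀^D)` is finite and
perfectly paired with `Ш¹(K, M₀^{DD})` into `ℤ/n`.  Properties (a)(b)(c) of `Ψ` are theorems
(`HomDualShaTwoObstruction` §4).  HONEST FRAMING: a reduction; closes nothing.
[cite: MilneADT2006, Ch. I, Thm. 4.10 (a) (proof, p. 58), Lemma 4.13, Thm. 1.8][cite: Harari2020, Thm. 17.13 (b)] -/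
theorem shaTwo_tateDual_of_shaTwoObstruction [IsTotallyComplex K] {n : ℕ} [NeZero n]
    (hcomp : (LocalInvariants.canonical K n).SelmerComplement)
    (inv : Abelian.Ext (triv (Γ := absoluteGaloisGroup K) ℤ) (classBarD K) 2 →+ AddCircle (1 : ℚ))
    (hT : TateDualityHypotheses (classBarD K) inv) (π : ∀ v : Place K, IdeleProjection K v)
    {M : Type} [AddCommGroup M] [TopologicalSpace M] [DiscreteTopology M] [Finite M] [Finite (TateDual K M n)]
    (ρ₀ : DiscreteGaloisModule K M) (hM : ∀ m : M, n • m = 0)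
    (S₀ : Finset (Place K)) (hinf : ∀ w : InfinitePlace K, (Sum.inl w : Place K) ∈ S₀)
    (hS₀ : ∀ v : HeightOneSpectrum (𝓞 K), (Sum.inr v : Place K) ∉ S₀ →
      ((n : ℕ) : 𝓞 K) ∉ v.asIdeal ∧ GaloisRep.IsUnramifiedAt v (ρ₀.tateDual n))
    [Finite (sha ((ρ₀.tateDual n).tateDual n))]
    (hR3 : ∀ T : Finset (Place K), (∀ w : InfinitePlace K, (Sum.inl w : Place K) ∈ T) →
      (∀ v : HeightOneSpectrum (𝓞 K), (Sum.inr v : Place K) ∉ T →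
        ((n : ℕ) : 𝓞 K) ∉ v.asIdeal ∧ GaloisRep.IsUnramifiedAt v (ρ₀.tateDual n)) →
      ∀ t : Π v : Place K, galoisCohomology ((ρ₀.tateDual n).toLocal v) 1,
        (∀ v : HeightOneSpectrum (𝓞 K), (Sum.inr v : Place K) ∉ T →
          t (Sum.inr v) ∈ unramifiedSubgroup (GaloisRep.toLocal v (ρ₀.tateDual n)) 1) →
        ∃ f : (presentationComplex ρ₀).X₁ ⟶ (ideleClassLimitShortComplex K).X₂,
          ∀ v : Place K, readout ρ₀ n hM (π v) f = t v)
    (nat : galoisCohomology ((ρ₀.tateDual n).tateDual n) 1 →+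
      Abelian.Ext (triv (Γ := absoluteGaloisGroup K) ℤ) (presentationComplex ρ₀).X₃ 1)
    (hnat : Function.Bijective nat)
    (hR4 : ∀ f : (presentationComplex ρ₀).X₁ ⟶ (ideleClassLimitShortComplex K).X₂, ∃ Tf : Finset (Place K),
      ∀ (y : galoisCohomology ((ρ₀.tateDual n).tateDual n) 1) (T' : Finset (Place K)), Tf ⊆ T' →
        (∀ v : HeightOneSpectrum (𝓞 K), (Sum.inr v : Place K) ∉ T' →
          galoisCohomology.localization ((ρ₀.tateDual n).tateDual n) (Sum.inr v) 1 y ∈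
            unramifiedSubgroup (GaloisRep.toLocal v ((ρ₀.tateDual n).tateDual n)) 1) →
        zmodToQmodZ n (∑ v ∈ T', localTatePairingZMod (ρ₀.tateDual n) n v (LocalInvariants.canonical K n v)
          (readout ρ₀ n hM (π v) f)
          (galoisCohomology.localization ((ρ₀.tateDual n).tateDual n) v 1 y)) =
        inv ((nat y).comp (boundary (presentationComplex_shortExact ρ₀) (classBarD K)
          (f ≫ (ideleClassLimitShortComplex K).g)) (rfl : 1 + 1 = 2)))
    (hΨsha : ∀ h : (presentationComplex ρ₀).X₁ ⟶ classBarD K,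
      shaTwoObstruction' ρ₀ n hM h ∈ shaTwo (ρ₀.tateDual n))
    (hΨsurj : ∀ c ∈ shaTwo (ρ₀.tateDual n), ∃ h : (presentationComplex ρ₀).X₁ ⟶ classBarD K,
      shaTwoObstruction' ρ₀ n hM h = c) :
    Finite (shaTwo (ρ₀.tateDual n)) ∧
      ∃ b : shaTwo (ρ₀.tateDual n) →+ sha ((ρ₀.tateDual n).tateDual n) →+ ZMod n,
        Function.Bijective b ∧ Function.Bijective b.flip :=
  shaTwo_tateDual_of_ideleProjection hcomp inv hT π ρ₀ hM S₀ hinf hS₀ hR3 nat hnat hR4 (shaTwoObstruction' ρ₀ n hM)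
    (shaTwoObstruction'_comp_g ρ₀ n hM) (shaTwoObstruction'_f_comp ρ₀ n hM)
    (exists_comp_g_eq_of_shaTwoObstruction'_eq_zero ρ₀ n hM) hΨsha hΨsurj

end Plugged

/-! ## §2 Transport along isomorphisms of Galois modules; finiteness of `Ш¹` -/

section Transport

variable {K : Type} [Field K] [NumberField K]
  {M₁ M₂ : Type} [AddCommGroup M₁] [TopologicalSpace M₁] [DiscreteTopology M₁]
  [AddCommGroup M₂] [TopologicalSpace M₂] [DiscreteTopology M₂]
  {ρ₁ : DiscreteGaloisModule K M₁} {ρ₂ : DiscreteGaloisModule K M₂}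

omit [NumberField K] in
/-- **`H²(g) (H²(f) x) = x` when `g ∘ f = id` pointwise** (functoriality of `H²` on explicit `2`-cocycles).
[cite: MilneADT2006, Ch. I §0] -/
theorem map_map_eq_self_of_comp_eq_two (f : ρ₁.toContRepresentation →ⁱL ρ₂.toContRepresentation)
    (g : ρ₂.toContRepresentation →ⁱL ρ₁.toContRepresentation) (hcomp : ∀ a : M₁, g (f a) = a)
    (x : galoisCohomology ρ₁ 2) : galoisCohomology.map g 2 (galoisCohomology.map f 2 x) = x := by
  haveI := absoluteGaloisGroup_compactSpace K
  obtain ⟨c, rfl⟩ := twoCocycleClass_surjective _ x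
  change cohomologyMap (DiscreteGaloisModule.homOfIntertwining g) 2
      (cohomologyMap (DiscreteGaloisModule.homOfIntertwining f) 2 (twoCocycleClass _ c)) = _
  rw [cohomologyMap_twoCocycleClass, cohomologyMap_twoCocycleClass]
  exact congrArg (twoCocycleClass _) (Subtype.ext (ContinuousMap.ext fun p => hcomp _))

/-- **`H²(f)` carries `Ш²(K, M₁)` into `Ш²(K, M₂)`** (`K` totally complex: naturality of localisation at the finite
places, `H² = 0` at the complex ones). [cite: MilneADT2006, Ch. I §4 (definition of `Ш²`)] -/
theorem map_mem_shaTwo [IsTotallyComplex K] (f : ρ₁.toContRepresentation →ⁱL ρ₂.toContRepresentation)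
    {x : galoisCohomology ρ₁ 2} (hx : x ∈ shaTwo ρ₁) : galoisCohomology.map f 2 x ∈ shaTwo ρ₂ := by
  rw [mem_shaTwo_iff] at hx ⊢
  rintro (w | v)
  · exact WeakLeopoldt.localization_inl_two_eq_zero (IsTotallyComplex.isComplex w) _
  · rw [WeakLeopoldt.localization_inr_map_two, hx (Sum.inr v)]
    exact map_zero _

/-- **`Ш²(K, M₁) ≃ Ш²(K, M₂)` along an isomorphism `M₁ ≅ M₂` of Galois modules** (`K` totally complex).
[cite: MilneADT2006, Ch. I §4] -/
theorem nonempty_shaTwo_addEquiv [IsTotallyComplex K] (f : ρ₁.toContRepresentation →ⁱL ρ₂.toContRepresentation)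
    (g : ρ₂.toContRepresentation →ⁱL ρ₁.toContRepresentation) (hgf : ∀ a : M₁, g (f a) = a)
    (hfg : ∀ b : M₂, f (g b) = b) : Nonempty (shaTwo ρ₁ ≃+ shaTwo ρ₂) :=
  ⟨{ toFun := fun c => ⟨galoisCohomology.map f 2 c, map_mem_shaTwo f c.2⟩
     invFun := fun c => ⟨galoisCohomology.map g 2 c, map_mem_shaTwo g c.2⟩
     left_inv := fun c => Subtype.ext (map_map_eq_self_of_comp_eq_two f g hgf c)
     right_inv := fun c => Subtype.ext (map_map_eq_self_of_comp_eq_two g f hfg c)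
     map_add' := fun _ _ => Subtype.ext (map_add _ _ _) }⟩

/-- **`Ш¹(K, M₁) ≃ Ш¹(K, M₂)` along an isomorphism `M₁ ≅ M₂` of Galois modules.** [cite: MilneADT2006, Ch. I §4] -/
theorem nonempty_sha_addEquiv (f : ρ₁.toContRepresentation →ⁱL ρ₂.toContRepresentation)
    (g : ρ₂.toContRepresentation →ⁱL ρ₁.toContRepresentation) (hgf : ∀ a : M₁, g (f a) = a)
    (hfg : ∀ b : M₂, f (g b) = b) : Nonempty (sha ρ₁ ≃+ sha ρ₂) :=
  ⟨{ toFun := fun c => ⟨galoisCohomology.map f 1 c, ShaBound.map_mem_sha f c.2⟩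
     invFun := fun c => ⟨galoisCohomology.map g 1 c, ShaBound.map_mem_sha g c.2⟩
     left_inv := fun c => Subtype.ext (Levels.map_map_eq_self_of_comp_eq f g hgf c)
     right_inv := fun c => Subtype.ext (Levels.map_map_eq_self_of_comp_eq g f hfg c)
     map_add' := fun _ _ => Subtype.ext (map_add _ _ _) }⟩

/-- Bijectivity of an adjoint is carried along additive equivalences on both sides. [folklore] -/
theorem bijective_of_addEquiv_pairing {C C' D D' Z : Type*} [AddCommGroup C] [AddCommGroup C'] [AddCommGroup D]
    [AddCommGroup D'] [AddCommGroup Z] (eC : C' ≃+ C) (eD : D' ≃+ D) (p : C →+ D →+ Z) (p' : C' →+ D' →+ Z)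
    (hp' : ∀ c' d', p' c' d' = p (eC c') (eD d')) (hp : Function.Bijective p) : Function.Bijective p' := by
  constructor
  · intro c₁ c₂ h
    apply eC.injective
    apply hp.1
    ext d
    obtain ⟨d', rfl⟩ := eD.surjective d
    rw [← hp', ← hp', h]
  · intro φ
    obtain ⟨c, hc⟩ := hp.2 (φ.comp eD.symm.toAddMonoidHom)
    refine ⟨eC.symm c, ?_⟩
    ext d'
    rw [hp', eC.apply_symm_apply, hc, AddMonoidHom.comp_apply]
    change φ (eD.symm (eD d')) = φ d'
    rw [eD.symm_apply_apply]

/-- **A perfect pairing is carried along additive equivalences**: from `b : A →+ B →+ Z` with both adjoints bijective and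
`eA : A' ≃ A`, `eB : B' ≃ B`, the pairing `b'(a', y') = b(eA a', eB y')` has both adjoints bijective. [folklore] -/
theorem exists_perfect_of_addEquiv {A A' B B' Z : Type*} [AddCommGroup A] [AddCommGroup A'] [AddCommGroup B]
    [AddCommGroup B'] [AddCommGroup Z] (eA : A' ≃+ A) (eB : B' ≃+ B) (b : A →+ B →+ Z)
    (hb : Function.Bijective b) (hbflip : Function.Bijective b.flip) :
    ∃ b' : A' →+ B' →+ Z, (∀ a' y', b' a' y' = b (eA a') (eB y')) ∧ Function.Bijective b' ∧ Function.Bijective b'.flip := by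
  let b' : A' →+ B' →+ Z :=
    { toFun := fun a' => (b (eA a')).comp eB.toAddMonoidHom
      map_zero' := by rw [map_zero, map_zero, AddMonoidHom.zero_comp]
      map_add' := fun a₁ a₂ => by rw [map_add, map_add, AddMonoidHom.add_comp] }
  have hb' : ∀ a' y', b' a' y' = b (eA a') (eB y') := fun _ _ => rfl
  refine ⟨b', hb', bijective_of_addEquiv_pairing eA eB b b' hb' hb,
    bijective_of_addEquiv_pairing eB eA b.flip b'.flip (fun y' a' => ?_) hbflip⟩
  rw [AddMonoidHom.flip_apply, AddMonoidHom.flip_apply, hb']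

/-- **`Ш¹(K, M)` is finite** for a finite Galois module unramified outside a finite set of places `S₀ ⊇ {v ∣ ∞}`
(Milne I Lemma 4.8: `Ш¹ ≤` the Selmer group of the structure "strict on `S₀`, unramified off `S₀`", finite by the
tree's `SelmerFinite.finite_selmerGroup_of_isUnramifiedOutside`). [cite: MilneADT2006, Ch. I, Lemma 4.8] -/
theorem finite_sha_of_isUnramifiedOutside [Finite M₁] (ρ : DiscreteGaloisModule K M₁) (S₀ : Finset (Place K))
    (hinf : ∀ w : InfinitePlace K, (Sum.inl w : Place K) ∈ S₀)
    (hS₀ : ∀ v : HeightOneSpectrum (𝓞 K), (Sum.inr v : Place K) ∉ S₀ → GaloisRep.IsUnramifiedAt v ρ) :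
    Finite (sha ρ) := by
  classical
  let 𝓢 : SelmerStructure ρ := SelmerStructure.ofFinite ρ fun v =>
    if (Sum.inr v : Place K) ∈ S₀ then ⊥ else unramifiedSubgroup (GaloisRep.toLocal v ρ) 1
  have h𝓢 : 𝓢.IsUnramifiedOutside S₀ := ⟨hinf, fun v hv => by
    simp only [𝓢, SelmerStructure.ofFinite_inr, if_neg hv]⟩
  haveI : Finite 𝓢.selmerGroup :=
    Summit.BirchSwinnertonDyer.Rank1Residual.GaloisImage.SelmerFinite.finite_selmerGroup_of_isUnramifiedOutside
      ρ hS₀ h𝓢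
  exact Finite.of_injective (AddSubgroup.inclusion (DiscreteGaloisModule.sha_le_selmerGroup ρ 𝓢))
    (AddSubgroup.inclusion_injective _)

end Transport

/-! ## §3 The named fact `poitouTate_sha_tateDual K` for a totally complex `K` -/

section Assembly

variable {K : Type} [Field K] [NumberField K]

/-- **THE NAMED FACT `poitouTate_sha_tateDual K` (Milne I Thm. 4.10 (a): `Ш²(K, M)` and `Ш¹(K, M^D)` finite and
perfectly paired into `ℤ/n`, all `n ≥ 1`, all finite `n`-torsion `M`) for a TOTALLY COMPLEX `K`, from the presentation
road of cell `bsd-schneider` plus the degree-`2` obstruction map.**  Inputs, each quantified over all levels `n ≥ 1` and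
all finite `n`-torsion modules `M₀`: Tate duality for `(Γ_K, C̄, inv)` (door-c4, landed for `inv = classBarInvD K`); ONE
family `π` of idèle projections with the (R3) property for the idèle readout of the canonical presentation; the bridge
`nat` with the (R4) identity; `SelmerComplement` of the canonical invariant maps (= `hE(n)`); (d) and (e) for
`Ψ = shaTwoObstruction' ρ₀ n hM`; and the finiteness of ramification of finite Galois modules (`hS₀`).  The pairing for
`M` is transported from the road's pairing for `(Ш²(K, M^{DD}), Ш¹(K, M^{DDD}))` (at `ρ₀ := ρ^D`) along the biduality
`M ≅ M^{DD}` (`exists_bidual_intertwining`).  HONEST FRAMING: a reduction with displayed hypotheses; no case of BSD.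
[cite: MilneADT2006, Ch. I, Thm. 4.10 (a) (proof, p. 58), Lemma 4.8, Prop. 0.19][cite: Harari2020, Thm. 17.13 (b)] -/
theorem poitouTate_sha_tateDual_of_shaTwoObstruction [IsTotallyComplex K]
    (hcomp : ∀ (n : ℕ) [NeZero n], (LocalInvariants.canonical K n).SelmerComplement)
    (inv : Abelian.Ext (triv (Γ := absoluteGaloisGroup K) ℤ) (classBarD K) 2 →+ AddCircle (1 : ℚ))
    (hT : TateDualityHypotheses (classBarD K) inv) (π : ∀ v : Place K, IdeleProjection K v)
    (hS₀ : ∀ (n : ℕ) [NeZero n],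
      ∀ ⦃M : Type⦄ [AddCommGroup M] [TopologicalSpace M] [DiscreteTopology M] [Finite M]
      (ρ : DiscreteGaloisModule K M), ∃ S₀ : Finset (Place K), (∀ w : InfinitePlace K, (Sum.inl w : Place K) ∈ S₀) ∧
        ∀ v : HeightOneSpectrum (𝓞 K), (Sum.inr v : Place K) ∉ S₀ →
          ((n : ℕ) : 𝓞 K) ∉ v.asIdeal ∧ GaloisRep.IsUnramifiedAt v ρ)
    (hR3 : ∀ (n : ℕ) [NeZero n],
      ∀ ⦃M : Type⦄ [AddCommGroup M] [TopologicalSpace M] [DiscreteTopology M] [Finite M] [Finite (TateDual K M n)]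
      (ρ₀ : DiscreteGaloisModule K M) (hM : ∀ m : M, n • m = 0),
      ∀ T : Finset (Place K), (∀ w : InfinitePlace K, (Sum.inl w : Place K) ∈ T) →
        (∀ v : HeightOneSpectrum (𝓞 K), (Sum.inr v : Place K) ∉ T →
          ((n : ℕ) : 𝓞 K) ∉ v.asIdeal ∧ GaloisRep.IsUnramifiedAt v (ρ₀.tateDual n)) →
        ∀ t : Π v : Place K, galoisCohomology ((ρ₀.tateDual n).toLocal v) 1,
          (∀ v : HeightOneSpectrum (𝓞 K), (Sum.inr v : Place K) ∉ T →
            t (Sum.inr v) ∈ unramifiedSubgroup (GaloisRep.toLocal v (ρ₀.tateDual n)) 1) →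
          ∃ f : (presentationComplex ρ₀).X₁ ⟶ (ideleClassLimitShortComplex K).X₂,
            ∀ v : Place K, readout ρ₀ n hM (π v) f = t v)
    (hR4 : ∀ (n : ℕ) [NeZero n],
      ∀ ⦃M : Type⦄ [AddCommGroup M] [TopologicalSpace M] [DiscreteTopology M] [Finite M] [Finite (TateDual K M n)]
      (ρ₀ : DiscreteGaloisModule K M) (hM : ∀ m : M, n • m = 0),
      ∃ nat : galoisCohomology ((ρ₀.tateDual n).tateDual n) 1 →+
          Abelian.Ext (triv (Γ := absoluteGaloisGroup K) ℤ) (presentationComplex ρ₀).X₃ 1,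
        Function.Bijective nat ∧
        ∀ f : (presentationComplex ρ₀).X₁ ⟶ (ideleClassLimitShortComplex K).X₂, ∃ Tf : Finset (Place K),
          ∀ (y : galoisCohomology ((ρ₀.tateDual n).tateDual n) 1) (T' : Finset (Place K)), Tf ⊆ T' →
            (∀ v : HeightOneSpectrum (𝓞 K), (Sum.inr v : Place K) ∉ T' →
              galoisCohomology.localization ((ρ₀.tateDual n).tateDual n) (Sum.inr v) 1 y ∈
                unramifiedSubgroup (GaloisRep.toLocal v ((ρ₀.tateDual n).tateDual n)) 1) →
            zmodToQmodZ n (∑ v ∈ T', localTatePairingZMod (ρ₀.tateDual n) n v (LocalInvariants.canonical K n v)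
              (readout ρ₀ n hM (π v) f)
              (galoisCohomology.localization ((ρ₀.tateDual n).tateDual n) v 1 y)) =
            inv ((nat y).comp (boundary (presentationComplex_shortExact ρ₀) (classBarD K)
              (f ≫ (ideleClassLimitShortComplex K).g)) (rfl : 1 + 1 = 2)))
    (hΨsha : ∀ (n : ℕ) [NeZero n],
      ∀ ⦃M : Type⦄ [AddCommGroup M] [TopologicalSpace M] [DiscreteTopology M] [Finite M]
      (ρ₀ : DiscreteGaloisModule K M) (hM : ∀ m : M, n • m = 0) (h : (presentationComplex ρ₀).X₁ ⟶ classBarD K),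
        shaTwoObstruction' ρ₀ n hM h ∈ shaTwo (ρ₀.tateDual n))
    (hΨsurj : ∀ (n : ℕ) [NeZero n],
      ∀ ⦃M : Type⦄ [AddCommGroup M] [TopologicalSpace M] [DiscreteTopology M] [Finite M]
      (ρ₀ : DiscreteGaloisModule K M) (hM : ∀ m : M, n • m = 0),
        ∀ c ∈ shaTwo (ρ₀.tateDual n), ∃ h : (presentationComplex ρ₀).X₁ ⟶ classBarD K,
          shaTwoObstruction' ρ₀ n hM h = c) :
    poitouTate_sha_tateDual K := by
  intro n _ M _ _ _ _ ρ hM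
  haveI : Finite (TateDual K M n) := DiscreteGaloisModule.TateDual.finite K M n
  haveI : Finite (TateDual K (TateDual K M n) n) := DiscreteGaloisModule.TateDual.finite K _ n
  haveI : Finite (TateDual K (TateDual K (TateDual K M n) n) n) := DiscreteGaloisModule.TateDual.finite K _ n
  -- the module to present: `ρ₀ := ρ^D`, so that the road speaks about `Ш²(ρ^{DD})` and `Ш¹(ρ^{DDD})`
  set ρ₀ : DiscreteGaloisModule K (TateDual K M n) := ρ.tateDual n with hρ₀
  have hM₀ : ∀ m : TateDual K M n, n • m = 0 := fun m => DiscreteGaloisModule.TateDual.nsmul_eq_zero m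
  -- ramification data and finiteness of the `Ш¹`'s
  obtain ⟨S₀, hinf, hS₀'⟩ := hS₀ n (ρ₀.tateDual n)
  obtain ⟨S₁, hinf₁, hS₁⟩ := hS₀ n ((ρ₀.tateDual n).tateDual n)
  obtain ⟨S₂, hinf₂, hS₂⟩ := hS₀ n (ρ.tateDual n)
  haveI : Finite (sha ((ρ₀.tateDual n).tateDual n)) :=
    finite_sha_of_isUnramifiedOutside _ S₁ hinf₁ fun v hv => (hS₁ v hv).2
  haveI hfin1 : Finite (sha (ρ.tateDual n)) :=
    finite_sha_of_isUnramifiedOutside _ S₂ hinf₂ fun v hv => (hS₂ v hv).2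
  -- the road at `ρ₀`
  obtain ⟨nat, hnat, hR4'⟩ := hR4 n ρ₀ hM₀
  obtain ⟨hfin2', b, hb, hbflip⟩ := shaTwo_tateDual_of_shaTwoObstruction (hcomp n) inv hT π ρ₀ hM₀ S₀ hinf hS₀'
    (hR3 n ρ₀ hM₀) nat hnat hR4' (hΨsha n ρ₀ hM₀) (hΨsurj n ρ₀ hM₀)
  -- biduality `M ≅ M^{DD}` and `M^D ≅ M^{DDD}`
  obtain ⟨ι, κ, -, hκι, hικ⟩ := exists_bidual_intertwining (n := n) ρ hM
  obtain ⟨ι', κ', -, hκι', hικ'⟩ := exists_bidual_intertwining (n := n) (ρ.tateDual n) hM₀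
  obtain ⟨eA⟩ : Nonempty (shaTwo ρ ≃+ shaTwo (ρ₀.tateDual n)) := nonempty_shaTwo_addEquiv ι κ hκι hικ
  obtain ⟨eB⟩ : Nonempty (sha (ρ.tateDual n) ≃+ sha ((ρ₀.tateDual n).tateDual n)) :=
    nonempty_sha_addEquiv ι' κ' hκι' hικ'
  haveI := hfin2'
  obtain ⟨b', -, hb', hb'flip⟩ := exists_perfect_of_addEquiv eA eB b hb hbflip
  exact ⟨hfin1, Finite.of_equiv _ eA.toEquiv.symm, b', hb', hb'flip⟩

end Assembly

end Summit.BirchSwinnertonDyer.BirchSwinnertonDyer.Theorems.PoitouTateShaTwoReadout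

end
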